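import Summits.AtomisticToContinuum.BoseEinsteinCondensation.Theorems.BECThomsonPrincipleDensityResponseKineticSignCoherence
import Summits.AtomisticToContinuum.BoseEinsteinCondensation.Theorems.DensityResponse.Negative.FreeChord

/-!
# Route `BECThomsonPrinciple`, crux `DensityResponse` (stmt-AtomisticToContinuum-9481),
# line `force-balance-constitutive` — calibration of the open core S2 (`ConstitutiveCore`)

Two honest side results around the open stub S2 `stub_constitutiveCore : ConstitutiveCore` of the skeleton
`Cruxes/DensityResponse/Lines/force-balance-constitutive.lean` (statements `CoreIneq`, `ConstitutiveCore` in
`Theorems/BECThomsonPrincipleDensityResponseDefs.lean`). They do not close S2; they calibrate it from below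
(its degenerate case is a theorem) and from above (it is not stronger than the crux on bounded potentials):

* `stub_constitutiveCoreFree` — **the degenerate case `a(v) = 0` of S2 holds.** If the envelope has zero
  scattering length then `v = 0` a.e. (LSSY App. C, `LSSY2005_zeroScatteringLength_holds`), hence every
  truncation `v_t ≤ v` vanishes a.e.; the drive window `0 ≤ s ≤ ρ·a = 0` is `{0}`, `E₀(v_t) = 0`
  (`periodicGroundStateEnergy_eq_zero_of_ae`), so a sub-ground state has `E_{v_t}(Φ) = 0`, and the free chord
  (`Theorems.DensityResponse.Negative.free_chord_energy`: `σ|m| ≤ E + 4σ²N/k∞²` for every `σ ≥ 0`) forces the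
  density wave `m(Φ) = 0`; by transport-stationarity `K_k + I_k = s·N_eff − (|k|²/4)m = 0`, and the constitutive
  inequality reads `0 ≤ 0`. Constants `ρ₀ = κ = C₁ = 1`, `N₀ = t₀ = 0`.
* `stub_coreOfCruxBounded` — **for bounded `v` the crux implies S2's `CoreIneq`** (with the crux's `ρ₀, N₀`,
  `κ = 1/4`, `C₁ = 3C`): linear response from the crux's chord at drive `2s` (and at every small drive if
  `s = 0`) on a sub-ground positively modulated state gives `m·(k∞² + ρa) ≤ 4CsN`; stationarity
  `K_k + I_k = s·N_eff − (|k|²/4)m ≥ −(|k|²/4)m` and `|k|² ≤ 3k∞²` (`ksq_le_three_mul_ksupSq`) give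
  `(ρa/4)·m ≤ K_k + I_k + 3C·s·N`.

Both are registered sub-goals of stmt-AtomisticToContinuum-9481 (`ledger workitem stub-add`), proved verbatim at the
end of the file. No named facts are used; `LSSY2005_zeroScatteringLength` enters through its discharged form
`LSSY2005_zeroScatteringLength_holds`.

References: Lieb–Seiringer–Solovej–Yngvason, *The Mathematics of the Bose Gas and its Condensation* (2005),
App. C, Thm. C.1 (zero scattering length); the stress/virial bookkeeping and the predicates are the `Defs` file's.
-/

namespace Summit.AtomisticToContinuum.BoseEinsteinCondensation.Cruxes.DensityResponse.ForceBalanceConstitutive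

open MeasureTheory
open scoped ENNReal
open Literature.MathematicalPhysics.QuantumManyBody.BoseGas
open Summit.AtomisticToContinuum.BoseEinsteinCondensation.Theses

noncomputable section

variable {N : ℕ} {L : ℝ}

/-! ### Elementary real / `ℝ≥0∞` bookkeeping -/

/-- A real number dominated by every positive multiple of a fixed constant through a quadratic bound,
`σ·m ≤ c·σ²` for all `σ > 0`, is non-positive (`m ≤ c·σ → 0`). [folklore] -/
theorem nonpos_of_forall_mul_le_sq {m c : ℝ} (h : ∀ σ : ℝ, 0 < σ → σ * m ≤ c * σ ^ 2) : m ≤ 0 := by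
  have h' : ∀ σ : ℝ, 0 < σ → m ≤ c * σ := fun σ hσ => by
    have h2 : σ * m ≤ σ * (c * σ) := by have := h σ hσ; linarith [show c * σ ^ 2 = σ * (c * σ) by ring]
    exact le_of_mul_le_mul_left h2 hσ
  rcases le_or_gt c 0 with hc | hc
  · exact (h' 1 one_pos).trans (by linarith)
  · refine le_of_forall_pos_le_add fun ε hε => ?_
    have h3 := h' (ε / c) (div_pos hε hc)
    have h4 : c * (ε / c) = ε := by field_simp
    linarith

/-- Real form of an `ℝ≥0∞` chord inequality `E₀ + x ≤ E + y` with `E < ∞`, `E₀ ≤ E`, `x, y ≥ 0`: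
`E₀.toReal + x ≤ E.toReal + y`. [folklore] -/
theorem toReal_chord {E₀ E : ℝ≥0∞} {x y : ℝ} (hE : E ≠ ⊤) (hE₀ : E₀ ≤ E) (hx : 0 ≤ x) (hy : 0 ≤ y)
    (h : E₀ + ENNReal.ofReal x ≤ E + ENNReal.ofReal y) : E₀.toReal + x ≤ E.toReal + y := by
  have hE₀' : E₀ ≠ ⊤ := ne_top_of_le_ne_top hE hE₀
  have h1 : (E₀ + ENNReal.ofReal x).toReal ≤ (E + ENNReal.ofReal y).toReal :=
    ENNReal.toReal_mono (ENNReal.add_ne_top.2 ⟨hE, ENNReal.ofReal_ne_top⟩) h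
  rwa [ENNReal.toReal_add hE₀' ENNReal.ofReal_ne_top, ENNReal.toReal_add hE ENNReal.ofReal_ne_top,
    ENNReal.toReal_ofReal hx, ENNReal.toReal_ofReal hy] at h1

/-- `k∞² > 0` for a non-zero mode (`L > 0`). [folklore] -/
theorem ksupSq_pos (hL : 0 < L) {n : Fin 3 → ℤ} (hn : n ≠ 0) : 0 < ksupSq L n := by
  have hnR : (fun j => (n j : ℝ)) ≠ 0 := by
    intro h0
    apply hn
    funext j
    have h1 : (n j : ℝ) = 0 := by simpa using congrFun h0 j
    show n j = 0
    exact_mod_cast h1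
  have := norm_pos_iff.mpr hnR
  unfold ksupSq
  positivity

/-! ### The degenerate case `a = 0`: interaction-free potentials -/

/-- **The constitutive inequality for an interaction-free potential at `a = 0`.** If `w` is measurable with
`w(|x|) = 0` for a.e. `x ∈ ℝ³`, then `CoreIneq w 0 M ρ₀ κ C₁ N₀` for all parameters: the window forces `s = 0`,
`E₀(w) = 0` makes a sub-ground state have `E_w(Φ) = 0`, the free chord at every drive `σ > 0` gives
`σ|m(Φ)| ≤ 4σ²N/k∞²`, so `m(Φ) = 0`, and stationarity gives `K_k + I_k = -(|k|²/4)m = 0`. [folklore] -/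
theorem coreIneq_of_ae_zero {w : ℝ → ℝ≥0∞} (hw : Measurable w) (hw0 : ∀ᵐ x : Space, w ‖x‖ = 0)
    (M ρ₀ κ C₁ : ℝ) (N₀ : ℕ) : CoreIneq w 0 M ρ₀ κ C₁ N₀ := by
  intro N _ L hL _ n hn _ s hs hs0 Φ hE hstat hsub hm
  -- the drive window is `{0}`
  have hs' : s = 0 := le_antisymm (by simpa using hs0) hs
  subst hs'
  -- `E₀ = 0`, hence `E_w(Φ) = 0` for the sub-ground state `Φ`
  rw [periodicGroundStateEnergy_eq_zero_of_ae hw hw0 N hL, ENNReal.toReal_zero, zero_mul, sub_zero] at hsub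
  have hE0 : periodicEnergy w Φ = 0 := by
    have h0 : (periodicEnergy w Φ).toReal = 0 := le_antisymm hsub ENNReal.toReal_nonneg
    rcases (ENNReal.toReal_eq_zero_iff _).1 h0 with h | h
    · exact h
    · exact absurd h hE
  -- the free chord at every drive `σ > 0` forces `m = 0`
  have hm0 : sourceMean n Φ ≤ 0 := by
    refine nonpos_of_forall_mul_le_sq (c := 4 * N / ksupSq L n) fun σ hσ => ?_
    have hc := Theorems.DensityResponse.Negative.free_chord_energy hL w hn hσ.le Φ
    rw [hE0, zero_add] at hc
    have hc' := (ENNReal.ofReal_le_ofReal_iff (by positivity)).1 hc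
    change σ * |sourceMean n Φ| ≤ 4 * σ ^ 2 * N / ksupSq L n at hc'
    calc σ * sourceMean n Φ ≤ σ * |sourceMean n Φ| := mul_le_mul_of_nonneg_left (le_abs_self _) hσ.le
      _ ≤ 4 * σ ^ 2 * N / ksupSq L n := hc'
      _ = 4 * N / ksupSq L n * σ ^ 2 := by ring
  have hm' : sourceMean n Φ = 0 := le_antisymm hm0 hm
  -- stationarity: `K + I = 0·N_eff − (|k|²/4)·0 = 0`
  have hKI : kineticStressWave n Φ + virialWave w n Φ = 0 := by
    unfold stressWave at hstat
    rw [hm'] at hstat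
    linarith
  rw [hm']
  linarith

/-! ### The bounded case: the crux implies the constitutive inequality -/

/-- **Linear response from the crux's chord, then the constitutive inequality.** If the body of
`DensityResponse` holds for `v` at `(N, L, n)` with constant `C` (for every drive `σ ≥ 0` and every state), then
`CoreIneq`'s conclusion holds at `(N, L, n)` with `κ = 1/4`, `C₁ = 3C` for every drive `s ≥ 0` and every
finite-energy, transport-stationary, sub-ground, positively modulated `Φ`: the chord at `σ = 2s` (or at every
small `σ` if `s = 0`) and the sub-ground condition give `m·(k∞² + ρa) ≤ 4CsN`; stationarity and `|k|² ≤ 3k∞²`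
finish. (The drive ceiling `s ≤ ρa` and the window are not used.) [folklore] -/
theorem coreIneq_body_of_chord {v : ℝ → ℝ≥0∞} {C : ℝ} (hC : 0 ≤ C) {N : ℕ} {L : ℝ} (hL : 0 < L)
    {n : Fin 3 → ℤ} (hn : n ≠ 0)
    (hchord : ∀ σ : ℝ, 0 ≤ σ → ∀ Φ : PeriodicTrialState N L,
      periodicGroundStateEnergy v N L + ENNReal.ofReal (σ * |sourceMean n Φ|) ≤
        periodicEnergy v Φ + ENNReal.ofReal (C * σ ^ 2 * N /
          (ksupSq L n + N / L ^ 3 * (scatteringLength v).toReal)))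
    {s : ℝ} (hs : 0 ≤ s) (Φ : PeriodicTrialState N L) (hE : periodicEnergy v Φ ≠ ⊤)
    (hstat : stressWave v n Φ = s * effNumber n Φ)
    (hsub : (periodicEnergy v Φ).toReal - s * sourceMean n Φ ≤ (periodicGroundStateEnergy v N L).toReal)
    (hm : 0 ≤ sourceMean n Φ) :
    1 / 4 * (N / L ^ 3 * (scatteringLength v).toReal) * sourceMean n Φ ≤
      kineticStressWave n Φ + virialWave v n Φ + 3 * C * s * N := by
  -- names for the real data
  have hqs0 : 0 < ksupSq L n := ksupSq_pos hL hn
  have hq3 : ksq L n ≤ 3 * ksupSq L n := ksq_le_three_mul_ksupSq L n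
  generalize hqs : ksupSq L n = qs at hqs0 hq3 hchord
  generalize hρa : (N : ℝ) / L ^ 3 * (scatteringLength v).toReal = ρa at hchord ⊢
  have hρa0 : 0 ≤ ρa := by rw [← hρa]; positivity
  have hD : 0 < qs + ρa := by positivity
  have hNnn : (0 : ℝ) ≤ N := Nat.cast_nonneg N
  have hE₀E : periodicGroundStateEnergy v N L ≤ periodicEnergy v Φ := periodicGroundStateEnergy_le v Φ
  -- the chord in real form at every drive `σ ≥ 0`
  have chord : ∀ σ : ℝ, 0 ≤ σ → (periodicGroundStateEnergy v N L).toReal + σ * |sourceMean n Φ| ≤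
      (periodicEnergy v Φ).toReal + C * σ ^ 2 * N / (qs + ρa) := fun σ hσ =>
    toReal_chord hE hE₀E (mul_nonneg hσ (abs_nonneg _)) (by positivity) (hchord σ hσ Φ)
  generalize (periodicGroundStateEnergy v N L).toReal = E₀r at chord hsub
  generalize (periodicEnergy v Φ).toReal = Er at chord hsub
  -- stationarity
  have hKI : kineticStressWave n Φ + virialWave v n Φ = s * effNumber n Φ - ksq L n / 4 * sourceMean n Φ := by
    unfold stressWave at hstat
    linarith
  have hsN : 0 ≤ s * effNumber n Φ := mul_nonneg hs (effNumber_nonneg n Φ)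
  generalize effNumber n Φ = Nf at hKI hsN
  generalize sourceMean n Φ = m at hm chord hsub hKI ⊢
  generalize kineticStressWave n Φ = K at hKI ⊢
  generalize virialWave v n Φ = I at hKI ⊢
  generalize ksq L n = q at hq3 hKI
  rw [abs_of_nonneg hm] at chord
  -- linear response: `m (k∞² + ρa) ≤ 4 C s N`
  have hlr : m * (qs + ρa) ≤ 4 * C * s * N := by
    rcases hs.eq_or_lt with h0 | hs'
    · -- `s = 0`: the chord at every small drive forces `m = 0`
      subst h0
      have hm0 : m ≤ 0 := by
        refine nonpos_of_forall_mul_le_sq (c := C * N / (qs + ρa)) fun σ hσ => ?_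
        have h1 := chord σ hσ.le
        have h2 : C * σ ^ 2 * N / (qs + ρa) = C * N / (qs + ρa) * σ ^ 2 := by ring
        linarith
      have hm00 : m = 0 := le_antisymm hm0 hm
      rw [hm00]; simp
    · -- `s > 0`: the chord at drive `2s`
      have h1 := chord (2 * s) (by linarith)
      have h2 : s * m ≤ C * (2 * s) ^ 2 * N / (qs + ρa) := by linarith
      rw [le_div_iff₀ hD] at h2
      have h3 : s * (m * (qs + ρa)) ≤ s * (4 * C * s * N) := by nlinarith [h2]
      exact le_of_mul_le_mul_left h3 hs'
  -- `(q + ρa) m ≤ 3 (k∞² + ρa) m ≤ 12 C s N`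
  have h3 : q * m ≤ 3 * qs * m := mul_le_mul_of_nonneg_right hq3 hm
  have h4 : 0 ≤ ρa * m := mul_nonneg hρa0 hm
  linarith [hlr, h3, h4, hsN, hKI]

/-! ### The two registered sub-goals -/

/-- **Registered sub-goal `stub_constitutiveCoreFree`: the degenerate case `a(v) = 0` of S2 (`ConstitutiveCore`)
is a theorem.** For an admissible envelope with zero scattering length, `v = 0` a.e. (LSSY App. C), so every
truncation `v_t` is interaction-free a.e. and `coreIneq_of_ae_zero` applies uniformly in `t ≥ 0`, with
`ρ₀ = κ = C₁ = 1`, `N₀ = t₀ = 0`. [folklore] -/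
theorem stub_constitutiveCoreFree : ∀ v : ℝ → ℝ≥0∞, IsRepulsiveFiniteRange v → scatteringLength v = 0 →
    ∀ M : ℝ, 0 < M → ∃ ρ₀ κ C₁ : ℝ, 0 < ρ₀ ∧ 0 < κ ∧ 0 < C₁ ∧ ∃ N₀ t₀ : ℕ, ∀ t : ℕ, t₀ ≤ t →
      CoreIneq (truncPotential v t) (scatteringLength v).toReal M ρ₀ κ C₁ N₀ := by
  intro v hv h0 M _
  obtain ⟨R₀, hR₀⟩ := hv.2
  have hv0 : ∀ᵐ x : Space, v ‖x‖ = 0 := LSSY2005_zeroScatteringLength_holds v R₀ hv.1 hR₀ h0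
  refine ⟨1, 1, 1, one_pos, one_pos, one_pos, 0, 0, fun t _ => ?_⟩
  rw [h0, ENNReal.toReal_zero]
  exact coreIneq_of_ae_zero (measurable_truncPotential hv.1 t)
    (hv0.mono fun x hx => truncPotential_eq_zero hx t) M 1 1 1 0

/-- **Registered sub-goal `stub_coreOfCruxBounded`: on bounded potentials the crux implies S2's constitutive
inequality** (strength calibration: S2 restricted to bounded `v`, where `v_t = v` for tall `t`, is not stronger
than `DensityResponse`). From the crux at `(v, M)` take its `ρ₀, N₀` and `κ = 1/4`, `C₁ = 3C`; the body is
`coreIneq_body_of_chord`. (Boundedness of `v` is not used by the proof; it is part of the registered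
calibration statement, matching S3a's hypothesis.) [folklore] -/
theorem stub_coreOfCruxBounded : BECThomsonPrinciple.DensityResponse → ∀ v : ℝ → ℝ≥0∞,
    IsRepulsiveFiniteRange v → (∃ B : ℝ, ∀ r, v r ≤ ENNReal.ofReal B) → ∀ M : ℝ, 0 < M →
      ∃ ρ₀ κ C₁ : ℝ, 0 < ρ₀ ∧ 0 < κ ∧ 0 < C₁ ∧ ∃ N₀ : ℕ,
        CoreIneq v (scatteringLength v).toReal M ρ₀ κ C₁ N₀ := by
  intro hDR v hv _ M hM
  obtain ⟨ρ₀, C, hρ₀, hC, N₀, h⟩ := hDR v hv M hM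
  refine ⟨ρ₀, 1 / 4, 3 * C, hρ₀, by norm_num, by positivity, N₀, ?_⟩
  intro N hN L hL hNL n hn hwin s hs _ Φ hE hstat hsub hm
  exact coreIneq_body_of_chord hC.le hL hn (fun σ hσ Φ' => h N hN L hL hNL n hn hwin σ hσ Φ') hs Φ hE
    hstat hsub hm

end

end Summit.AtomisticToContinuum.BoseEinsteinCondensation.Cruxes.DensityResponse.ForceBalanceConstitutive
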